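import Summits.QuantumFields.QCD.Theorems.SpectralDefectExtinctionTipNoBinding
import Literature.MathematicalPhysics.QuantumFieldTheory.SpectralDefectDensity

/-!
# Pointwise coercivity of the Wilson–Dirac operator in Seiler's positivity domain
# (helper for crux `MobilityGap`, stmt-QuantumFields-9150, line `Sketch`; lead c5, 2026-08-16)

For the `r = 1` Wilson–Dirac operator `D = D_W(U, m, 1)` of ANY `SU(3)` gauge field `U` on the
four-torus `(ℤ/L)⁴` at POSITIVE bare mass `m` with `m L⁴ ≥ 1` (the only volume condition), and every
spinor `v` and index `p`:

  `|v_p|² / K + (m/2) Σ_i |v_i|² ≤ Re⟨v, D v⟩`,  `K` an absolute constant.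

This is the input of the pointwise-coercive Combes–Thomas bound (`…MobilityGapPointwiseCombesThomas`);
it says that the real part of the Wilson form controls every single coordinate with an `O(1)`
constant, uniformly in the field, the volume and `m ↓ 0` — the lattice expression of the ultraviolet
finiteness of the massless scalar tadpole in four dimensions.  Everything is assembled from theorems
landed for the sibling crux `TipNoBinding` (stmt-QuantumFields-8965, line `positivity-no-leak-spread`):
Wilson positivity `Re⟨ψ, D_W(U,0,1)ψ⟩ = ½ Σ‖∇^U ψ‖²` (`stub_positivity`), Kato's sitewise diamagnetic
inequality (`stub_diamagnetic`), the four-torus Sobolev sup bound `f(x)² ≤ (2/L⁴)Σf² + 2K_L E(f)`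
(`stub_sobolevSup`) and the `d = 4` Green constant `K_L ≤ K₀` (`stub_greenBound`); plus the additive
mass shift `D_W(U,m,1) = D_W(U,0,1) + m` (`wilsonDirac_mass_eq_add_scalar`).

Chain: `Re⟨v, D(m)v⟩ = m‖v‖² + ½E_U(v) ≥ m‖v‖² + ½E(|v|) ≥ m‖v‖² + (|v|(x)² − 2‖v‖²/L⁴)/(4K)`
`≥ (m/2)‖v‖² + |v_p|²/(4K)` for `K = max(K₀,1)` and `m L⁴ ≥ 1`.  Pure theorem file.
-/

noncomputable section

namespace Summit.QuantumFields.QCD.Theorems.MobilityGapPositiveMass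

open scoped BigOperators
open Matrix Literature.MathematicalPhysics.QuantumFieldTheory Literature.MathematicalPhysics.QuantumLattice
  Literature.Probability.LatticeModels
open Summit.QuantumFields.QCD.Cruxes.TipNoBinding.PositivityNoLeakSpread

/-- **The mass enters the real part of the Wilson form additively**:
`Re⟨v, D_W(U,m,1)v⟩ = m Σ|v_i|² + Re⟨v, D_W(U,0,1)v⟩`. [folklore] -/
theorem re_form_wilsonDirac_mass {L : ℕ} [NeZero L] (U : GaugeConfig 4 L (Matrix.specialUnitaryGroup (Fin 3) ℂ)) (m : ℝ)
    (v : TorusSite 4 L × Fin 3 × Fin 4 → ℂ) :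
    (star v ⬝ᵥ (wilsonDirac (fundamentalRep (Fin 3)) U m 1 *ᵥ v)).re =
      m * ∑ i, ‖v i‖ ^ 2 + (star v ⬝ᵥ (wilsonDirac (fundamentalRep (Fin 3)) U 0 1 *ᵥ v)).re := by
  rw [wilsonDirac_mass_eq_add_scalar (fundamentalRep (Fin 3)) U m 1, Matrix.add_mulVec,
    dotProduct_add, Complex.add_re, Matrix.scalar_apply, ← smul_one_eq_diagonal, Matrix.smul_mulVec,
    Matrix.one_mulVec, re_star_dotProduct_smul, add_comm]

/-- **Wilson positivity at zero mass**: `0 ≤ Re⟨v, D_W(U,0,1) v⟩` (the right-hand side of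
`stub_positivity` is a sum of squares). [folklore] -/
theorem re_form_wilsonDirac_zero_nonneg {L : ℕ} [NeZero L] (U : GaugeConfig 4 L (Matrix.specialUnitaryGroup (Fin 3) ℂ))
    (v : TorusSite 4 L × Fin 3 × Fin 4 → ℂ) :
    0 ≤ (star v ⬝ᵥ (wilsonDirac (fundamentalRep (Fin 3)) U 0 1 *ᵥ v)).re := by
  rw [stub_positivity L U v]
  refine mul_nonneg (by norm_num) ?_
  exact Finset.sum_nonneg fun _ _ => Finset.sum_nonneg fun _ _ =>
    Finset.sum_nonneg fun _ _ => Finset.sum_nonneg fun _ _ => by positivity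

/-- **Spread bound at zero mass**: there is an absolute constant `K > 0` with
`Σ_{a,α} |v(x,a,α)|² ≤ (2/L⁴) Σ_i |v_i|² + K · Re⟨v, D_W(U,0,1) v⟩` for every torus, field, spinor
and site (Kato + Sobolev + Green constant + Wilson positivity; `K = 4 max(K₀,1)`). [folklore] -/
theorem site_sq_le_re_form :
    ∃ K : ℝ, 1 ≤ K ∧ ∀ (L : ℕ) [NeZero L] (U : GaugeConfig 4 L (Matrix.specialUnitaryGroup (Fin 3) ℂ))
      (v : TorusSite 4 L × Fin 3 × Fin 4 → ℂ) (x : TorusSite 4 L),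
        ∑ a, ∑ α, ‖v (x, a, α)‖ ^ 2 ≤ (2 / (L : ℝ) ^ 4) * ∑ i, ‖v i‖ ^ 2 +
          K * (star v ⬝ᵥ (wilsonDirac (fundamentalRep (Fin 3)) U 0 1 *ᵥ v)).re := by
  classical
  obtain ⟨K₀, hK₀⟩ := stub_greenBound
  refine ⟨4 * max K₀ 1, by linarith [le_max_right K₀ 1], ?_⟩
  intro L _ U v x
  have hK1 : (1 : ℝ) ≤ max K₀ 1 := le_max_right _ _
  -- the site modulus `f = |v|`
  obtain ⟨f, hfdef⟩ : ∃ f : TorusSite 4 L → ℝ,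
      f = fun y => Real.sqrt (∑ a, ∑ α, ‖v (y, a, α)‖ ^ 2) := ⟨_, rfl⟩
  have hsq0 : ∀ y, 0 ≤ ∑ a, ∑ α, ‖v (y, a, α)‖ ^ 2 := fun y =>
    Finset.sum_nonneg fun _ _ => Finset.sum_nonneg fun _ _ => by positivity
  have hfx : ∀ y, f y ^ 2 = ∑ a, ∑ α, ‖v (y, a, α)‖ ^ 2 := fun y => by
    rw [hfdef]; exact Real.sq_sqrt (hsq0 y)
  have hsumf : ∑ y, f y ^ 2 = ∑ i, ‖v i‖ ^ 2 := by
    simp only [hfx, sum_norm_sq_eq_sum_site]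
  -- the three landed inputs
  have hpos := stub_positivity L U v
  have hkato : ∑ y, ∑ μ, (f (Literature.MathematicalPhysics.QuantumFieldTheory.Site.shift y μ) - f y) ^ 2 ≤
      ∑ y, ∑ μ, ∑ a, ∑ α, ‖(∑ b, (U (y, μ) : Matrix (Fin 3) (Fin 3) ℂ) a b *
        v (Literature.MathematicalPhysics.QuantumFieldTheory.Site.shift y μ, b, α)) - v (y, a, α)‖ ^ 2 := by
    refine Finset.sum_le_sum fun y _ => Finset.sum_le_sum fun μ _ => ?_
    have h := stub_diamagnetic L U v y μ
    rw [hfdef]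
    exact h
  have hsob := stub_sobolevSup L f x
  have hGK := hK₀ L
  rw [hsumf] at hsob
  rw [← hfx x]
  -- scalar bookkeeping
  generalize (∑ y, ∑ μ, ∑ a, ∑ α, ‖(∑ b, (U (y, μ) : Matrix (Fin 3) (Fin 3) ℂ) a b *
        v (Literature.MathematicalPhysics.QuantumFieldTheory.Site.shift y μ, b, α)) - v (y, a, α)‖ ^ 2) = EU
    at hpos hkato
  have hE0 : 0 ≤ ∑ y, ∑ μ, (f (Literature.MathematicalPhysics.QuantumFieldTheory.Site.shift y μ) - f y) ^ 2 :=
    Finset.sum_nonneg fun _ _ => Finset.sum_nonneg fun _ _ => sq_nonneg _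
  generalize (∑ y, ∑ μ, (f (Literature.MathematicalPhysics.QuantumFieldTheory.Site.shift y μ) - f y) ^ 2) = E
    at hkato hsob hE0
  generalize ((1 / (L : ℝ) ^ 4) * ∑ k ∈ (Finset.univ : Finset (TorusSite 4 L)).filter (· ≠ 0),
      1 / (∑ μ, 4 * Real.sin (Real.pi * ((k μ).val : ℝ) / L) ^ 2)) = G at hsob hGK
  generalize (∑ i, ‖v i‖ ^ 2) = P at hsob ⊢
  rw [hpos]
  have h1 : G * E ≤ max K₀ 1 * E := mul_le_mul_of_nonneg_right (hGK.trans (le_max_left _ _)) hE0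
  have h2 : max K₀ 1 * E ≤ max K₀ 1 * EU := mul_le_mul_of_nonneg_left hkato (by linarith)
  nlinarith [hsob, h1, h2, hK1]

/-- **Pointwise coercivity of the Wilson–Dirac operator at positive bare mass.**  There is an
absolute constant `K > 0` such that for every torus side `L`, every `SU(3)` gauge field `U`, every
bare mass `m > 0` with `1 ≤ m L⁴`, every spinor `v` and every index `p`,
`|v_p|²/K + (m/2) Σ_i |v_i|² ≤ Re⟨v, D_W(U,m,1) v⟩`.
Proof: the spread bound at zero mass and the additive mass shift; the volume condition absorbs the
zero-mode term `2/L⁴`. [folklore] -/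
theorem wilson_pointwise_coercive :
    ∃ K : ℝ, 0 < K ∧ ∀ (L : ℕ) [NeZero L] (U : GaugeConfig 4 L (Matrix.specialUnitaryGroup (Fin 3) ℂ)) (m : ℝ), 0 < m →
      1 ≤ m * (L : ℝ) ^ 4 → ∀ (v : TorusSite 4 L × Fin 3 × Fin 4 → ℂ) (p : TorusSite 4 L × Fin 3 × Fin 4),
        ‖v p‖ ^ 2 / K + m / 2 * ∑ i, ‖v i‖ ^ 2 ≤
          (∑ i, star (v i) * (wilsonDirac (fundamentalRep (Fin 3)) U m 1 *ᵥ v) i).re := by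
  obtain ⟨K, hK1, hK⟩ := site_sq_le_re_form
  have hKpos : 0 < K := zero_lt_one.trans_le hK1
  refine ⟨4 * K, by positivity, ?_⟩
  intro L _ U m hm hmL v p
  have hL1 : (1 : ℝ) ≤ L := by exact_mod_cast Nat.one_le_iff_ne_zero.mpr (NeZero.ne L)
  have hL4 : (0 : ℝ) < (L : ℝ) ^ 4 := by positivity
  have hsite := hK L U v p.1
  -- the single coordinate is dominated by the site modulus
  have hvp : ‖v p‖ ^ 2 ≤ ∑ a, ∑ α, ‖v (p.1, a, α)‖ ^ 2 := by
    obtain ⟨x, a, α⟩ := p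
    calc ‖v (x, a, α)‖ ^ 2 ≤ ∑ α', ‖v (x, a, α')‖ ^ 2 :=
          Finset.single_le_sum (f := fun α' => ‖v (x, a, α')‖ ^ 2) (fun _ _ => by positivity)
            (Finset.mem_univ α)
      _ ≤ ∑ a', ∑ α', ‖v (x, a', α')‖ ^ 2 :=
          Finset.single_le_sum (f := fun a' => ∑ α', ‖v (x, a', α')‖ ^ 2)
            (fun _ _ => Finset.sum_nonneg fun _ _ => by positivity) (Finset.mem_univ a)
  have hform : (∑ i, star (v i) * (wilsonDirac (fundamentalRep (Fin 3)) U m 1 *ᵥ v) i).re =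
      m * ∑ i, ‖v i‖ ^ 2 + (star v ⬝ᵥ (wilsonDirac (fundamentalRep (Fin 3)) U 0 1 *ᵥ v)).re := by
    have h : (∑ i, star (v i) * (wilsonDirac (fundamentalRep (Fin 3)) U m 1 *ᵥ v) i) =
        star v ⬝ᵥ (wilsonDirac (fundamentalRep (Fin 3)) U m 1 *ᵥ v) := rfl
    rw [h, re_form_wilsonDirac_mass]
  rw [hform]
  have hP0 : 0 ≤ ∑ i, ‖v i‖ ^ 2 := Finset.sum_nonneg fun _ _ => by positivity
  generalize (∑ i, ‖v i‖ ^ 2) = P at hsite hP0 ⊢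
  have hR0 : 0 ≤ (star v ⬝ᵥ (wilsonDirac (fundamentalRep (Fin 3)) U 0 1 *ᵥ v)).re :=
    re_form_wilsonDirac_zero_nonneg U v
  generalize (star v ⬝ᵥ (wilsonDirac (fundamentalRep (Fin 3)) U 0 1 *ᵥ v)).re = R at hsite hR0 ⊢
  -- `(2/L⁴) P ≤ 2 m P` by the volume condition
  have hvol : (2 / (L : ℝ) ^ 4) * P ≤ 2 * m * P := by
    refine mul_le_mul_of_nonneg_right ?_ hP0
    rw [div_le_iff₀ hL4]
    nlinarith
  have hdiv : ‖v p‖ ^ 2 / (4 * K) ≤ (2 * m * P + K * R) / (4 * K) :=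
    div_le_div_of_nonneg_right (hvp.trans (hsite.trans (by linarith))) (by positivity)
  have hsplit : (2 * m * P + K * R) / (4 * K) = m * P / (2 * K) + R / 4 := by
    field_simp
    ring
  have hmP : m * P / (2 * K) ≤ m * P / 2 := by
    apply div_le_div_of_nonneg_left (by positivity) (by norm_num) (by linarith)
  have hR4 : R / 4 ≤ R := by linarith
  linarith [hdiv, hsplit.le, hmP, hR4]

end Summit.QuantumFields.QCD.Theorems.MobilityGapPositiveMass

end
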